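import Summits.Schanuel.Schanuel.Theorems.RootDecomp1HSigmaAx
import Summits.Schanuel.Schanuel.Theorems.RootDecomp1HMirror
import Summits.Schanuel.Schanuel.Theorems.RootDecomp1HMirrorItems
import Summits.Schanuel.Schanuel.Theorems.RootDecomp1HHull
import Summits.Schanuel.Schanuel.Theorems.RootDecomp1HBlockClearance
import Summits.Schanuel.Schanuel.Theorems.RootDecomp1HClearance
import Summits.Schanuel.Schanuel.Theorems.RootDecomp1BConjStableReduction

/-!
# RootDecomp1HSigma — ROUND 13 «Σ» of route `RootDecomp1H` (cell decomp-schanuel, lens 5, generation 13), part 2 of 2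

IMPORT NOTE for the census port: `RootDecomp1HMirror` = T12 part 2 (p776948: `ConjSchanuelRank`, `conjSchanuelRank_iff_delta`,
`schanuel_iff_conjSchanuel`, …) and `RootDecomp1HMirrorItems` = PLACEHOLDER NAME for T12 part 3 («Items» + §5 Σ-design:
`SigmaPresentable`, `ConjLowerRanks`, `CE`, `CS`, `FinCSσ`, `BridgeCSσ`, `StarLocalisationσ`, `starLocalisationσ_of_sigmaPresentable`,
`closes_sigma'`) — replace by the module name part 3 actually lands under (same namespace `…Theorems.RootDecomp1HMirror`).

§2 **`sigmaPresentable_holds : SigmaPresentable`** — the KERNEL of round 13: if Schanuel holds below `n` at the `σ`-stable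
`ℚ`-free tuples (`σ` = complex conjugation) and `x ∈ ℂⁿ` is `σ`-stable, `ℚ`-free with `trdeg ℚ(x, eˣ) < n`, then `(x, eˣ)` is a
non-degenerate Khovanskii point of its own `ℚ`-locus.  Proof = part 1's constants alternative read as `δ(C) + 1 ≤ δ(V)` for
`C = span z ≤ V = span x`, then SUBMODULAR SYMMETRISATION inside `V`: `δ(C ∩ σC) + δ(C + σC) ≤ δ(C) + δ(σC) = 2 δ(C)`, both
`C ∩ σC` and `C + σC` are `σ`-stable subspaces of `V`, the `σ`-lower ranks give `δ ≥ 0` on the proper ones and `C + σC = V` gives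
`δ = δ(V) ≤ −1` — contradiction either way.  No `±`-basis, no field automorphism of `ℚ(x, eˣ)`, no derivation extension.
§3 consequences: `starLocalisationσ_holds`, and the ACCEPTANCE TEST `schanuel_of_finCSσ_of_bridgeCSσ : FinCSσ → BridgeCSσ → Schanuel`
(= `closes_sigma'` specialised at the kernel).  §4 the Σ RE-INDEXING KIT: item texts `StarLocalisationSigma` (support, proved),
`FinCSSigma` (crux), `BridgeTransverseSigma` (crux, declared residual), `BridgeSigmaGlue` (support, proved from the hull theorem),
`ConjStableReduction` (support = the CLOSED item 24625 verbatim); `Iff.rfl` twins with the §5 constants of `RootDecomp1HMirror`; the pure-logic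
deciding theorem `closesSigma` (7 binders, 4 open: `FinCSSigma`, `ProductSchanuel`, `RelTowerSchanuel`, `BridgeTransverseSigma`) and
`schanuel_of_sigma_pieces`.  §5 the residual's readings of record survive: `sharp_of_structural` (clearance `≥ 3` is lower-rank-free
under `ProductSchanuel ∧ RelTowerSchanuel`) and `bridgeTransverseSigma_iff_bridgeSharpSigma`.

Sources: [cite: Kirby2010, Lemma 4.8, Prop. 7.2]; [cite: Ax1971, Thm 3]; [cite: BaysKirby2018ANT, Lemma 4.2 (submodularity)];
V. Mantova, «Involutions on Zilber fields» (arXiv:1109.6155) for the `σ`-side context.  Lens seat (planner role), node g13;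
0 sorry; axioms of every theorem ⊆ [propext, Classical.choice, Quot.sound] (g13/check, g13/bc).
-/

noncomputable section

set_option linter.dupNamespace false

namespace Summit.Schanuel.Schanuel.Theorems.RootDecomp1HSigma

open Complex Set
open Literature.NumberTheory.Transcendental
open Literature.NumberTheory.Transcendental.GammaField
open Summit.Schanuel.Schanuel.Theses.RootDecomp1H
open Summit.Schanuel.Schanuel.Theorems.RootDecomp1HMirror

variable {n : ℕ}

/-! ## §2 The `σ`-presentability theorem: `SigmaPresentable` HOLDS

In predimension language (`δ Λ = td(Λ ∪ e^Λ) − dim Λ`, landed `RootDecomp1HMirrorCore`): Ax's alternative is a PROPER subspace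
`C = span z < V = span x` with `δ C ≤ δ V − 1`.  If `V` is `σ`-stable (`σ` = complex conjugation) and a counterexample
(`δ V ≤ −1`), put `C' = σC ≤ V`; `δ C' = δ C` (`delta_map_conjQ`) and submodularity (`delta_submod`) give
`δ(C + C') + δ(C ∩ C') ≤ 2 δ C ≤ 2 δ V − 2`.  Both `C + C'` and `C ∩ C'` are `σ`-STABLE subspaces of `V`; `C ∩ C'` is proper, so
the `σ`-lower ranks give `δ(C ∩ C') ≥ 0`; and `C + C'` is either proper (`δ ≥ 0`) or all of `V` (`δ = δ V`).  Either way
`δ V ≥ 2` or `0 ≤ 2 δ V − 2`, contradicting `δ V ≤ −1`.  Hence the constants alternative is impossible and `(x, eˣ)` is a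
non-degenerate Khovanskii point.  No `±`-basis, no field automorphism of `ℚ(x, eˣ)`, no derivation extension is needed:
the symmetrisation happens on SUBSPACES of `V`, not on the derivation. -/

/-- **`SigmaPresentable` holds**: under Schanuel in the lower ranks AT `σ`-STABLE TUPLES ONLY, a `σ`-stable `ℚ`-free
counterexample `x ∈ ℂⁿ` is a non-degenerate Khovanskii point of its own `ℚ`-locus.
[cite: Kirby2010, Lemma 4.8 and Prop. 7.2; Ax1971, Thm 3; BaysKirby2018ANT, Lemma 4.2] -/
theorem sigmaPresentable_holds : SigmaPresentable := by
  classical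
  intro n x hlow hce hcs
  rcases khovanskii_or_constants hce.1 with h | ⟨m, n', hnm, hmn, z, hzli, hzx, H⟩
  · exact h
  exfalso
  haveI hVfin : FiniteDimensional ℚ ↥(Submodule.span ℚ (range x)) := FiniteDimensional.span_of_finite ℚ (finite_range x)
  haveI hCfin : FiniteDimensional ℚ ↥(Submodule.span ℚ (range z)) := FiniteDimensional.span_of_finite ℚ (finite_range z)
  set V : Submodule ℚ ℂ := Submodule.span ℚ (range x) with hV
  set C : Submodule ℚ ℂ := Submodule.span ℚ (range z) with hC
  have hCV : C ≤ V := Submodule.span_le.2 (Set.range_subset_iff.2 hzx)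
  have hVσ : V.map conjQ ≤ V := (map_conjQ_span_le_iff x).2 hcs
  have hδV : δ V ≤ -1 := (predim_le_neg_one_iff hce.1).2 hce.2
  have hδC : δ C + 1 ≤ δ V := delta_succ_le_of_trdeg hzli hce.1 (by omega) H
  have hfinV : Module.finrank ℚ V = n := by rw [hV, finrank_span_eq_card hce.1, Fintype.card_fin]
  have hfinC : Module.finrank ℚ C = m := by rw [hC, finrank_span_eq_card hzli, Fintype.card_fin]
  set C' : Submodule ℚ ℂ := C.map conjQ with hC'
  have hC'V : C' ≤ V := (Submodule.map_mono hCV).trans hVσ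
  have hδC' : δ C' = δ C := delta_map_conjQ C
  have hsub := delta_submod C C'
  -- `C ⊓ C'` is `σ`-stable and proper
  have hinfσ : (C ⊓ C').map conjQ ≤ C ⊓ C' := by
    refine (Submodule.map_inf_le _).trans ?_
    rw [hC', map_conjQ_map_conjQ, inf_comm]
  have hinf_lt : Module.finrank ℚ ↥(C ⊓ C') < n :=
    lt_of_le_of_lt (Submodule.finrank_mono inf_le_left) (by rw [hfinC]; exact hmn)
  have hδinf : 0 ≤ δ (C ⊓ C') := (conjSchanuelRank_iff_delta _).1 (hlow _ hinf_lt) (C ⊓ C') inferInstance rfl hinfσ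
  -- `C ⊔ C'` is `σ`-stable and `≤ V`
  have hsupσ : (C ⊔ C').map conjQ ≤ C ⊔ C' := by
    rw [Submodule.map_sup, hC', map_conjQ_map_conjQ, sup_comm]
  have hsupV : C ⊔ C' ≤ V := sup_le hCV hC'V
  by_cases heq : Module.finrank ℚ ↥(C ⊔ C') = n
  · have hCC'V : C ⊔ C' = V := Submodule.eq_of_le_of_finrank_eq hsupV (by rw [heq, hfinV])
    rw [hCC'V] at hsub
    linarith
  · have hlt : Module.finrank ℚ ↥(C ⊔ C') < n := lt_of_le_of_ne (hfinV ▸ Submodule.finrank_mono hsupV) heq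
    have hδsup : 0 ≤ δ (C ⊔ C') := (conjSchanuelRank_iff_delta _).1 (hlow _ hlt) _ inferInstance rfl hsupσ
    linarith

/-! ## §3 Consequences: the `σ`-localisation and the THREE-binder conditional `FinCSσ → BridgeCSσ → Schanuel` -/

/-- The Σ-support `StarLocalisationσ` HOLDS (the `c⋆`-localisation under the `σ`-lower ranks). -/
theorem starLocalisationσ_holds : StarLocalisationσ :=
  starLocalisationσ_of_sigmaPresentable sigmaPresentable_holds

/-- **Acceptance test** (critic R13): `closes_sigma'` specialises to the conditional `FinCSσ → BridgeCSσ → Schanuel` — Schanuel's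
conjecture follows from the INSTRUMENT and the BRIDGE indexed by `σ`-stable rank, with NO symmetry binder and NO localisation binder. -/
theorem schanuel_of_finCSσ_of_bridgeCSσ (h₂ : FinCSσ) (h₃ : BridgeCSσ) : _root_.Schanuel :=
  closes_sigma' sigmaPresentable_holds h₂ h₃

/-! ## §4 The Σ RE-INDEXING KIT (item texts over tree constants, twins, glue, padding, deciding theorem)

The `σ`-lower-ranks hypothesis spelled RAW (no node-local constant):
«`∀ m < n, ∀ x : Fin m → ℂ, LinearIndependent ℚ x → (∀ j, conj (x j) ∈ span_ℚ x) → m ≤ trdeg ℚ(x, eˣ)`».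
Item texts below are the live texts of `StarLocalisation` 27288 / `FinCS` 27287 / `BridgeTransverse` 30564 with that hypothesis in
place of «`∀ m < n, SchanuelRank m`»; `ProductSchanuel` 28261 and `RelTowerSchanuel` 28933 (no lower-rank hypothesis) are reused
VERBATIM; `BridgeSigmaGlue` is the collapsed glue (hull theorem); the PADDING binder is the text of the CLOSED item
`RootDecomp1B.ConjStableReduction` (stmt-Schanuel-24625, proved `RootDecomp1BConjStableReduction.conjStableReduction_holds`: every
counterexample yields a conjugation-stable counterexample of some rank), reused VERBATIM so that it deduplicates to 24625 — the mirror
ladder `schanuel_iff_conjSchanuel` (T12 part 2) is then not needed by the route at all (the route's `closes` cannot import Theorems,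
so the padding must be an item; this one is already closed). -/

/-- Σ-item text `StarLocalisationSigma` (support; PROVED: `starLocalisationSigma_holds`). -/
def StarLocalisationSigma : Prop :=
  ∀ (n : ℕ) (x : Fin n → ℂ), ((∀ m < n, ∀ z : Fin m → ℂ, LinearIndependent ℚ z → (∀ j, (starRingEnd ℂ) (z j) ∈ Submodule.span ℚ (Set.range z)) → (m : Cardinal) ≤ Algebra.trdeg ℚ ↥(IntermediateField.adjoin ℚ (Set.range z ∪ Set.range (Complex.exp ∘ z)))) ∧ LinearIndependent ℚ x ∧ Algebra.trdeg ℚ ↥(IntermediateField.adjoin ℚ (Set.range x ∪ Set.range (Complex.exp ∘ x))) < (n : Cardinal)) → (∀ j, (starRingEnd ℂ) (x j) ∈ Submodule.span ℚ (Set.range x)) → ∃ c : ℕ, ∃ y : Fin n → ℂ, ((∀ m < n, ∀ z : Fin m → ℂ, LinearIndependent ℚ z → (∀ j, (starRingEnd ℂ) (z j) ∈ Submodule.span ℚ (Set.range z)) → (m : Cardinal) ≤ Algebra.trdeg ℚ ↥(IntermediateField.adjoin ℚ (Set.range z ∪ Set.range (Complex.exp ∘ z)))) ∧ LinearIndependent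 ℚ y ∧ Algebra.trdeg ℚ ↥(IntermediateField.adjoin ℚ (Set.range y ∪ Set.range (Complex.exp ∘ y))) < (n : Cardinal)) ∧ (∀ j, (starRingEnd ℂ) (y j) ∈ Submodule.span ℚ (Set.range y)) ∧ (((∃ g : Fin n → MvPolynomial (Fin n ⊕ Fin n) ℚ, (∀ i, max (g i).totalDegree ((g i).support.sup fun m => max ((g i).coeff m).num.natAbs ((g i).coeff m).den) ≤ c) ∧ (∀ i, MvPolynomial.aeval (Sum.elim y (Complex.exp ∘ y)) (g i) = 0) ∧ (Matrix.of fun i j => MvPolynomial.aeval (Sum.elim y (Complex.exp ∘ y)) (Literature.NumberTheory.Transcendental.Khovanskii.ePD j (g i))).det ≠ 0) ∧ ‖y‖ ≤ ((4 ^ c : ℕ) : ℝ)) ∧ ∀ c' < c, ¬ (∃ y' : Fin n → ℂ, Submodule.span ℚ (Set.range y) = Submodule.span ℚ (Set.range y') ∧ (∃ g' : Fin n → MvPolynomial (Fin n ⊕ Fin n) ℚ, (∀ i, max (g' i).totalDegree ((g' i).support.sup fun m => max ((g' i).coeff m).num.natAbs ((g' i).coeff m).den) ≤ c') ∧ (∀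 i, MvPolynomial.aeval (Sum.elim y' (Complex.exp ∘ y')) (g' i) = 0) ∧ (Matrix.of fun i j => MvPolynomial.aeval (Sum.elim y' (Complex.exp ∘ y')) (Literature.NumberTheory.Transcendental.Khovanskii.ePD j (g' i))).det ≠ 0) ∧ ‖y'‖ ≤ ((4 ^ c' : ℕ) : ℝ)))

/-- Σ-item text `FinCSSigma` (crux, the INSTRUMENT under the `σ`-lower ranks; formally STRONGER than `FinCS` 27287). -/
def FinCSSigma : Prop :=
  ∀ (n c : ℕ), (∀ m < n, ∀ z : Fin m → ℂ, LinearIndependent ℚ z → (∀ j, (starRingEnd ℂ) (z j) ∈ Submodule.span ℚ (Set.range z)) → (m : Cardinal) ≤ Algebra.trdeg ℚ ↥(IntermediateField.adjoin ℚ (Set.range z ∪ Set.range (Complex.exp ∘ z)))) → ∀ y : Fin n → ℂ, (((∃ g : Fin n → MvPolynomial (Fin n ⊕ Fin n) ℚ, (∀ i, max (g i).totalDegree ((g i).support.sup fun m => max ((g i).coeff m).num.natAbs ((g i).coeff m).den) ≤ c) ∧ (∀ i, MvPolynomial.aeval (Sum.elim y (Complex.exp ∘ y)) (g i) = 0) ∧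 (Matrix.of fun i j => MvPolynomial.aeval (Sum.elim y (Complex.exp ∘ y)) (Literature.NumberTheory.Transcendental.Khovanskii.ePD j (g i))).det ≠ 0) ∧ ‖y‖ ≤ ((4 ^ c : ℕ) : ℝ)) ∧ ∀ c' < c, ¬ (∃ y' : Fin n → ℂ, Submodule.span ℚ (Set.range y) = Submodule.span ℚ (Set.range y') ∧ (∃ g' : Fin n → MvPolynomial (Fin n ⊕ Fin n) ℚ, (∀ i, max (g' i).totalDegree ((g' i).support.sup fun m => max ((g' i).coeff m).num.natAbs ((g' i).coeff m).den) ≤ c') ∧ (∀ i, MvPolynomial.aeval (Sum.elim y' (Complex.exp ∘ y')) (g' i) = 0) ∧ (Matrix.of fun i j => MvPolynomial.aeval (Sum.elim y' (Complex.exp ∘ y')) (Literature.NumberTheory.Transcendental.Khovanskii.ePD j (g' i))).det ≠ 0) ∧ ‖y'‖ ≤ ((4 ^ c' : ℕ) : ℝ))) → (∀ j, (starRingEnd ℂ) (y j) ∈ Submodule.span ℚ (Set.range y)) → (¬ LinearIndependent ℚ y ∨ ¬ (∃ P : Fin (n + 1) → MvPolynomial (Fin n ⊕ Fin n) ℤ,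 (∀ i, max (P i).totalDegree ((P i).support.sup fun m => ((P i).coeff m).natAbs) ≤ c + 3) ∧ (∀ i, MvPolynomial.aeval (Sum.elim y (Complex.exp ∘ y)) (P i) = 0) ∧ LinearIndependent ℂ (fun i => fun s : Fin n ⊕ Fin n => MvPolynomial.aeval (Sum.elim y (Complex.exp ∘ y)) (MvPolynomial.pderiv s (P i)))))

/-- Σ-item text `BridgeTransverseSigma` (crux, DECLARED RESIDUAL: `BridgeTransverse` 30564 with the `σ`-lower ranks as hypothesis). -/
def BridgeTransverseSigma : Prop :=
  ∀ (n c : ℕ), (∀ m < n, ∀ z : Fin m → ℂ, LinearIndependent ℚ z → (∀ j, (starRingEnd ℂ) (z j) ∈ Submodule.span ℚ (Set.range z)) → (m : Cardinal) ≤ Algebra.trdeg ℚ ↥(IntermediateField.adjoin ℚ (Set.range z ∪ Set.range (Complex.exp ∘ z)))) → ∀ y : Fin n → ℂ, (((∃ g : Fin n → MvPolynomial (Fin n ⊕ Fin n) ℚ, (∀ i, max (g i).totalDegree ((g i).support.sup fun m => max ((g i).coeff m).num.natAbs ((g i).coeff m).den) ≤ c) ∧ (∀ i, MvPolynomial.aeval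 (Sum.elim y (Complex.exp ∘ y)) (g i) = 0) ∧ (Matrix.of fun i j => MvPolynomial.aeval (Sum.elim y (Complex.exp ∘ y)) (Literature.NumberTheory.Transcendental.Khovanskii.ePD j (g i))).det ≠ 0) ∧ ‖y‖ ≤ ((4 ^ c : ℕ) : ℝ)) ∧ ∀ c' < c, ¬ (∃ y' : Fin n → ℂ, Submodule.span ℚ (Set.range y) = Submodule.span ℚ (Set.range y') ∧ (∃ g' : Fin n → MvPolynomial (Fin n ⊕ Fin n) ℚ, (∀ i, max (g' i).totalDegree ((g' i).support.sup fun m => max ((g' i).coeff m).num.natAbs ((g' i).coeff m).den) ≤ c') ∧ (∀ i, MvPolynomial.aeval (Sum.elim y' (Complex.exp ∘ y')) (g' i) = 0) ∧ (Matrix.of fun i j => MvPolynomial.aeval (Sum.elim y' (Complex.exp ∘ y')) (Literature.NumberTheory.Transcendental.Khovanskii.ePD j (g' i))).det ≠ 0) ∧ ‖y'‖ ≤ ((4 ^ c' : ℕ) : ℝ))) → (∀ j, (starRingEnd ℂ) (y j) ∈ Submodule.span ℚ (Set.range y)) → (LinearIndependent ℚ y ∧ Algebra.trdeg ℚ ↥(IntermediateField.adjoin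 ℚ (Set.range y ∪ Set.range (Complex.exp ∘ y))) < (n : Cardinal)) → (¬ ∃ (N : ℕ) (b : Fin N → ℂ), LinearIndependent ℚ b ∧ (∀ (k : ℕ) (hk : k ≤ N), Algebra.trdeg ℚ ↥(IntermediateField.adjoin ℚ (Set.range (b ∘ Fin.castLE hk) ∪ Set.range (Complex.exp ∘ (b ∘ Fin.castLE hk)))) ≤ (k : Cardinal)) ∧ ∀ j, y j ∈ Submodule.span ℚ (Set.range b)) → (∃ P : Fin (n + 1) → MvPolynomial (Fin n ⊕ Fin n) ℤ, (∀ i, max (P i).totalDegree ((P i).support.sup fun m => ((P i).coeff m).natAbs) ≤ c + 3) ∧ (∀ i, MvPolynomial.aeval (Sum.elim y (Complex.exp ∘ y)) (P i) = 0) ∧ LinearIndependent ℂ (fun i => fun s : Fin n ⊕ Fin n => MvPolynomial.aeval (Sum.elim y (Complex.exp ∘ y)) (MvPolynomial.pderiv s (P i))))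

/-- Σ-item text `BridgeSigmaGlue` (support/glue; PROVED: `bridgeSigmaGlue_holds`): off the residual, a `σ`-stable first failure in
the tower hull is forbidden outright by the hull theorem (`RootDecomp1HHull.not_lt_of_inTowerHull`). Conclusion = `BridgeCSσ` raw. -/
def BridgeSigmaGlue : Prop :=
  ProductSchanuel → RelTowerSchanuel → BridgeTransverseSigma →
  ∀ (n c : ℕ), (∀ m < n, ∀ z : Fin m → ℂ, LinearIndependent ℚ z → (∀ j, (starRingEnd ℂ) (z j) ∈ Submodule.span ℚ (Set.range z)) → (m : Cardinal) ≤ Algebra.trdeg ℚ ↥(IntermediateField.adjoin ℚ (Set.range z ∪ Set.range (Complex.exp ∘ z)))) → ∀ y : Fin n → ℂ, (((∃ g : Fin n → MvPolynomial (Fin n ⊕ Fin n) ℚ, (∀ i, max (g i).totalDegree ((g i).support.sup fun m => max ((g i).coeff m).num.natAbs ((g i).coeff m).den) ≤ c) ∧ (∀ i, MvPolynomial.aeval (Sum.elim y (Complex.exp ∘ y)) (g i) = 0) ∧ (Matrix.of fun i j => MvPolynomial.aeval (Sum.elim y (Complex.exp ∘ y)) (Literature.NumberTheory.Transcendental.Khovanskii.ePD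 j (g i))).det ≠ 0) ∧ ‖y‖ ≤ ((4 ^ c : ℕ) : ℝ)) ∧ ∀ c' < c, ¬ (∃ y' : Fin n → ℂ, Submodule.span ℚ (Set.range y) = Submodule.span ℚ (Set.range y') ∧ (∃ g' : Fin n → MvPolynomial (Fin n ⊕ Fin n) ℚ, (∀ i, max (g' i).totalDegree ((g' i).support.sup fun m => max ((g' i).coeff m).num.natAbs ((g' i).coeff m).den) ≤ c') ∧ (∀ i, MvPolynomial.aeval (Sum.elim y' (Complex.exp ∘ y')) (g' i) = 0) ∧ (Matrix.of fun i j => MvPolynomial.aeval (Sum.elim y' (Complex.exp ∘ y')) (Literature.NumberTheory.Transcendental.Khovanskii.ePD j (g' i))).det ≠ 0) ∧ ‖y'‖ ≤ ((4 ^ c' : ℕ) : ℝ))) → (∀ j, (starRingEnd ℂ) (y j) ∈ Submodule.span ℚ (Set.range y)) → (LinearIndependent ℚ y ∧ Algebra.trdeg ℚ ↥(IntermediateField.adjoin ℚ (Set.range y ∪ Set.range (Complex.exp ∘ y))) < (n : Cardinal)) → (∃ P : Fin (n + 1) → MvPolynomial (Fin n ⊕ Fin n) ℤ, (∀ i, max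 (P i).totalDegree ((P i).support.sup fun m => ((P i).coeff m).natAbs) ≤ c + 3) ∧ (∀ i, MvPolynomial.aeval (Sum.elim y (Complex.exp ∘ y)) (P i) = 0) ∧ LinearIndependent ℂ (fun i => fun s : Fin n ⊕ Fin n => MvPolynomial.aeval (Sum.elim y (Complex.exp ∘ y)) (MvPolynomial.pderiv s (P i))))

/-- Σ-item text `ConjStableReduction` (support) = the text of the CLOSED item stmt-Schanuel-24625 (`RootDecomp1B.ConjStableReduction`)
VERBATIM (deduplicates to it): every counterexample to Schanuel's conjecture yields a conjugation-stable counterexample of some rank. -/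
def ConjStableReduction : Prop :=
  ∀ (n : ℕ) (z : Fin n → ℂ), LinearIndependent ℚ z → Algebra.trdeg ℚ ↥(IntermediateField.adjoin ℚ (Set.range z ∪ Set.range (Complex.exp ∘ z))) < (n : Cardinal) → ∃ (d : ℕ) (w : Fin d → ℂ), LinearIndependent ℚ w ∧ (∀ j, (starRingEnd ℂ) (w j) ∈ Submodule.span ℚ (Set.range w)) ∧ Algebra.trdeg ℚ ↥(IntermediateField.adjoin ℚ (Set.range w ∪ Set.range (Complex.exp ∘ w))) < (d : Cardinal)

/-! ### Twins with the Σ-design constants of `RootDecomp1HMirror` §5 (all `Iff.rfl`) -/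

/-- `StarLocalisationSigma ↔ StarLocalisationσ`. -/
theorem starLocalisationSigma_iff : StarLocalisationSigma ↔ StarLocalisationσ := Iff.rfl

/-- `FinCSSigma ↔ FinCSσ`. -/
theorem finCSSigma_iff : FinCSSigma ↔ FinCSσ := Iff.rfl

/-- `BridgeSigmaGlue ↔ (ProductSchanuel → RelTowerSchanuel → BridgeTransverseSigma → BridgeCSσ)`. -/
theorem bridgeSigmaGlue_iff : BridgeSigmaGlue ↔ (ProductSchanuel → RelTowerSchanuel → BridgeTransverseSigma → BridgeCSσ) :=
  Iff.rfl

/-- The node-local `ConjStableReduction` is the CLOSED 1B item 24625 verbatim (`Iff.rfl`). -/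
theorem conjStableReduction_iff :
    ConjStableReduction ↔ Summit.Schanuel.Schanuel.Theses.RootDecomp1B.ConjStableReduction := Iff.rfl

/-! ### The supports are theorems -/

/-- `StarLocalisationSigma`. -/
theorem starLocalisationSigma_holds : StarLocalisationSigma := starLocalisationσ_holds

/-- The collapsed Σ-glue: verbatim the landed `RootDecomp1HHull.bridgeCyclicGlue_holds` (the three landed glues of 1H only PASS
the lower-rank hypothesis through; the hull theorem takes none). -/
theorem bridgeSigmaGlue_holds : BridgeSigmaGlue := by
  intro hPS hRT hT n c hlow y hopt hcs hce
  by_cases hh : ∃ (N : ℕ) (b : Fin N → ℂ), LinearIndependent ℚ b ∧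
      (∀ (k : ℕ) (hk : k ≤ N), Algebra.trdeg ℚ ↥(IntermediateField.adjoin ℚ (Set.range (b ∘ Fin.castLE hk) ∪ Set.range (Complex.exp ∘ (b ∘ Fin.castLE hk)))) ≤ (k : Cardinal)) ∧
      ∀ j, y j ∈ Submodule.span ℚ (Set.range b)
  · exact absurd hce.2 (RootDecomp1HHull.not_lt_of_inTowerHull hPS hRT hce.1 hh)
  · exact hT n c hlow y hopt hcs hce hh

/-- `ConjStableReduction`. -/
theorem conjStableReduction_holds : ConjStableReduction :=
  RootDecomp1BConjStableReduction.conjStableReduction_holds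

/-- The padding the Σ-induction needs, from 24625 in three lines (the mirror ladder `schanuel_iff_conjSchanuel` gives it too). -/
theorem schanuel_of_conjSchanuelRank (h₉ : ConjStableReduction) (h : ∀ m, ConjSchanuelRank m) : _root_.Schanuel := by
  intro n z hz
  by_contra hlt
  rw [not_le] at hlt
  obtain ⟨d, w, hw, hwcs, hwlt⟩ := h₉ n z hz hlt
  exact absurd (h d w hw hwcs) (not_le.2 hwlt)

/-- Formal strength: the Σ-items imply the live ones (weaker lower-rank hypothesis) … -/
theorem finCS_of_finCSSigma (h : FinCSSigma) : FinCS :=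
  fun n c hlow y hopt hcs => h n c (fun m hm z hz _ => hlow m hm z hz) y hopt hcs

/-- `BridgeTransverse`. -/
theorem bridgeTransverse_of_bridgeTransverseSigma (h : BridgeTransverseSigma) : BridgeTransverse :=
  fun n c hlow y hopt hcs hce hnh => h n c (fun m hm z hz _ => hlow m hm z hz) y hopt hcs hce hnh

/-- … and the residual stays necessary (vacuously, like every first-failure-local piece). -/
theorem bridgeTransverseSigma_of_schanuel (h : _root_.Schanuel) : BridgeTransverseSigma :=
  fun n _ _ y _ _ hce _ => absurd (h n y hce.1) (not_le.2 hce.2)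

/-! ### The Σ deciding theorem (pure logic over the seven items — three supports proved, 24625 already CLOSED; four open and load-bearing:
`FinCSSigma`, `ProductSchanuel`, `RelTowerSchanuel`, `BridgeTransverseSigma`) -/

/-- **Σ-`closes`**: strong induction on the `σ`-STABLE rank, then the padding.  No symmetry binder. -/
theorem closesSigma (h₀ : StarLocalisationSigma) (h₂ : FinCSSigma) (h₃ : ProductSchanuel) (h₄ : RelTowerSchanuel)
    (h₅ : BridgeTransverseSigma) (h₆ : BridgeSigmaGlue) (h₉ : ConjStableReduction) : _root_.Schanuel := by
  -- (1) Schanuel at the σ-stable tuples of every rank, by strong induction on the rank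
  have key : ∀ (n : ℕ) (x : Fin n → ℂ), LinearIndependent ℚ x →
      (∀ j, (starRingEnd ℂ) (x j) ∈ Submodule.span ℚ (Set.range x)) →
      (n : Cardinal) ≤ Algebra.trdeg ℚ ↥(IntermediateField.adjoin ℚ (Set.range x ∪ Set.range (Complex.exp ∘ x))) := by
    intro n
    induction n using Nat.strong_induction_on with
    | _ n ih =>
      intro x hli hcs
      by_contra hlt
      rw [not_le] at hlt
      obtain ⟨c, y, hy, hycs, hopt⟩ := h₀ n x ⟨ih, hli, hlt⟩ hcs
      rcases h₂ n c hy.1 y hopt hycs with hdep | hfree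
      · exact hdep hy.2.1
      · exact hfree (h₆ h₃ h₄ h₅ n c hy.1 y hopt hycs hy.2)
  -- (2) the padding (item 24625): a counterexample anywhere gives a σ-stable counterexample somewhere
  intro n z hz
  by_contra hlt
  rw [not_le] at hlt
  obtain ⟨d, w, hw, hwcs, hwlt⟩ := h₉ n z hz hlt
  exact absurd (key d w hw hwcs) (not_le.2 hwlt)

/-- The Σ deciding theorem with its three supports discharged: **Schanuel ⟸ FinCSSigma ∧ ProductSchanuel ∧ RelTowerSchanuel ∧
BridgeTransverseSigma** (four open binders; compare the live `closes` of rev 15: the same four live pieces PLUS `FirstFailureConjStable`). -/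
theorem schanuel_of_sigma_pieces (h₂ : FinCSSigma) (h₃ : ProductSchanuel) (h₄ : RelTowerSchanuel)
    (h₅ : BridgeTransverseSigma) : _root_.Schanuel :=
  closesSigma starLocalisationSigma_holds h₂ h₃ h₄ h₅ bridgeSigmaGlue_holds conjStableReduction_holds

/-! ## §5 The residual's readings of record survive the re-indexing: SHARPNESS is lower-rank-free under the structural binders

`RootDecomp1HClearance.sharp_of_not_inTowerHull` (the reading of record of 30564: a first failure outside the tower hull stands three
storeys clear of every `ℚ`-free tower span) was proved from `clearance (hlow : LowerRanks n)`, which spends FULL Schanuel below `n` on a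
sub-tuple that need not be `σ`-stable; under the route's two structural binders the same conclusion needs NO lower ranks at all
(`RootDecomp1HBlockClearance.finrank_inf_curveHull_add_three_le_of_structural`: clearance `≥ 3` from the curve hull `𝓚 ⊇` every free
tower span).  Hence 1H's exact re-typing `bridgeTransverse_iff_bridgeSharp : BridgeTransverse ↔ BridgeSharp` ports to the Σ-items as
`ProductSchanuel → RelTowerSchanuel → (BridgeTransverseSigma ↔ BridgeSharpSigma)`. -/

/-- Under `ProductSchanuel ∧ RelTowerSchanuel`, a counterexample outside the tower hull is SHARP — no lower-rank hypothesis. -/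
theorem sharp_of_structural (hPS : ProductSchanuel) (hRT : RelTowerSchanuel) {n : ℕ} {y : Fin n → ℂ}
    (hce : RootDecomp1HClearance.CounterEx y) (hnh : ¬ RootDecomp1HClearance.InTowerHull y) :
    RootDecomp1HClearance.Sharp y := by
  classical
  intro N b hb htow m u hu huy hub
  haveI := FiniteDimensional.span_of_finite ℚ (Set.finite_range y)
  have hTS := RootDecomp1HCurveHull.towerSchanuel_of_structural hPS hRT
  have h3 := RootDecomp1HBlockClearance.finrank_inf_curveHull_add_three_le_of_structural hPS hRT hce.1 hce.2 hnh
  -- `u ⊂ span y ∩ span b ⊆ span y ∩ 𝓚`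
  have huK : ∀ j, u j ∈ Submodule.span ℚ (range y) ⊓ RootDecomp1HCurveHull.curveHull := by
    intro j
    refine Submodule.mem_inf.2 ⟨huy j, ?_⟩
    have ht : u j ∈ RootDecomp1HCurveHull.towerHullSet := ⟨N, b, hb, htow, hub j⟩
    rw [RootDecomp1HCurveHull.towerHullSet_eq_curveHull hTS] at ht
    exact ht
  -- so `m ≤ finrank (span y ⊓ 𝓚)`
  haveI : FiniteDimensional ℚ ↥(Submodule.span ℚ (range y) ⊓ RootDecomp1HCurveHull.curveHull) :=
    Submodule.finiteDimensional_of_le inf_le_left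
  have hcod : LinearIndependent ℚ (fun j => (⟨u j, huK j⟩ : ↥(Submodule.span ℚ (range y) ⊓ RootDecomp1HCurveHull.curveHull))) :=
    LinearIndependent.of_comp (Submodule.subtype _) (by simpa [Function.comp_def] using hu)
  have hm : m ≤ Module.finrank ℚ ↥(Submodule.span ℚ (range y) ⊓ RootDecomp1HCurveHull.curveHull) := by
    simpa using hcod.fintype_card_le_finrank
  omega

/-- Σ-form of `RootDecomp1HClearance.BridgeSharp`: its text with the `σ`-lower ranks as hypothesis. -/
def BridgeSharpSigma : Prop :=
  ∀ (n c : ℕ), (∀ m < n, ∀ z : Fin m → ℂ, LinearIndependent ℚ z → (∀ j, (starRingEnd ℂ) (z j) ∈ Submodule.span ℚ (Set.range z)) → (m : Cardinal) ≤ Algebra.trdeg ℚ ↥(IntermediateField.adjoin ℚ (Set.range z ∪ Set.range (Complex.exp ∘ z)))) → ∀ y : Fin n → ℂ, (((∃ g : Fin n → MvPolynomial (Fin n ⊕ Fin n) ℚ, (∀ i, max (g i).totalDegree ((g i).support.sup fun m => max ((g i).coeff m).num.natAbs ((g i).coeff m).den) ≤ c) ∧ (∀ i, MvPolynomial.aeval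 (Sum.elim y (Complex.exp ∘ y)) (g i) = 0) ∧ (Matrix.of fun i j => MvPolynomial.aeval (Sum.elim y (Complex.exp ∘ y)) (Literature.NumberTheory.Transcendental.Khovanskii.ePD j (g i))).det ≠ 0) ∧ ‖y‖ ≤ ((4 ^ c : ℕ) : ℝ)) ∧ ∀ c' < c, ¬ (∃ y' : Fin n → ℂ, Submodule.span ℚ (Set.range y) = Submodule.span ℚ (Set.range y') ∧ (∃ g' : Fin n → MvPolynomial (Fin n ⊕ Fin n) ℚ, (∀ i, max (g' i).totalDegree ((g' i).support.sup fun m => max ((g' i).coeff m).num.natAbs ((g' i).coeff m).den) ≤ c') ∧ (∀ i, MvPolynomial.aeval (Sum.elim y' (Complex.exp ∘ y')) (g' i) = 0) ∧ (Matrix.of fun i j => MvPolynomial.aeval (Sum.elim y' (Complex.exp ∘ y')) (Literature.NumberTheory.Transcendental.Khovanskii.ePD j (g' i))).det ≠ 0) ∧ ‖y'‖ ≤ ((4 ^ c' : ℕ) : ℝ))) → (∀ j, (starRingEnd ℂ) (y j) ∈ Submodule.span ℚ (Set.range y)) → (LinearIndependent ℚ y ∧ Algebra.trdeg ℚ ↥(IntermediateField.adjoin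 ℚ (Set.range y ∪ Set.range (Complex.exp ∘ y))) < (n : Cardinal)) → (∀ (N : ℕ) (b : Fin N → ℂ), LinearIndependent ℚ b → (∀ (k : ℕ) (hk : k ≤ N), Algebra.trdeg ℚ ↥(IntermediateField.adjoin ℚ (Set.range (b ∘ Fin.castLE hk) ∪ Set.range (Complex.exp ∘ (b ∘ Fin.castLE hk)))) ≤ (k : Cardinal)) → ∀ (m : ℕ) (u : Fin m → ℂ), LinearIndependent ℚ u → (∀ j, u j ∈ Submodule.span ℚ (Set.range y)) → (∀ j, u j ∈ Submodule.span ℚ (Set.range b)) → m + 3 ≤ n) → (∃ P : Fin (n + 1) → MvPolynomial (Fin n ⊕ Fin n) ℤ, (∀ i, max (P i).totalDegree ((P i).support.sup fun m => ((P i).coeff m).natAbs) ≤ c + 3) ∧ (∀ i, MvPolynomial.aeval (Sum.elim y (Complex.exp ∘ y)) (P i) = 0) ∧ LinearIndependent ℂ (fun i => fun s : Fin n ⊕ Fin n => MvPolynomial.aeval (Sum.elim y (Complex.exp ∘ y)) (MvPolynomial.pderiv s (P i))))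

/-- **EXACT RE-TYPING under the structural binders**: `BridgeTransverseSigma ↔ BridgeSharpSigma` (1H's
`bridgeTransverse_iff_bridgeSharp`, whose `←` direction spent `LowerRanks n`; here `ProductSchanuel ∧ RelTowerSchanuel` instead). -/
theorem bridgeTransverseSigma_iff_bridgeSharpSigma (hPS : ProductSchanuel) (hRT : RelTowerSchanuel) :
    BridgeTransverseSigma ↔ BridgeSharpSigma :=
  ⟨fun h n c hlow y hopt hcs hce hsh => h n c hlow y hopt hcs hce
      (RootDecomp1HClearance.not_inTowerHull_of_sharp (n := n) hce.1 hsh),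
    fun h n c hlow y hopt hcs hce hnh => h n c hlow y hopt hcs hce (sharp_of_structural hPS hRT (n := n) hce hnh)⟩


end Summit.Schanuel.Schanuel.Theorems.RootDecomp1HSigma


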